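import Mathlib
import Summits.Ventures.PercRepro2.LocRows
import Summits.Ventures.PercRepro2.SwRow
import Summits.Ventures.PercRepro2.SwOut
import Summits.Ventures.PercRepro2.SwAllRow
import Summits.Ventures.PercRepro2.SwOutAll
import Summits.Ventures.PercRepro2.SwOutReducible
import Summits.Ventures.PercRepro2.SwOutJunctionH1Defs
import Summits.Ventures.PercRepro2.SwOutJunctionH1EdgeExample
import Summits.Ventures.PercRepro2.SwOutJunctionH1BundleThm

/-!
# An instance of Theorem A with a bundle `h–u` (blind cell PercRepro2, night-4 g29, 2026-08-28;
proofs/NIGHT4-G29.md §9)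

`ex7b` = `ex7e` with a SECOND edge `h–u` (`Fin 12` edges, `l = 0`, `h = 1`, `o = 2`, the junction
`u = 3` joined to `h` by the two parallel edges `0` and `11`): a multigraph outside every theorem of
record and outside `sw_of_junctionH1_edge` (its edge `h–u` is not unique); `sw_of_junctionH1_bundle`
settles it (`sw_ex7b`).
-/

namespace Summit.Ventures.PercRepro2

namespace LocRows

open Hull

/-- The instance: `ex7e` with a second edge `h–u`. -/
def ex7b : Fin 12 → Sym2 (Fin 7)
  | 0 => s(1, 3) | 1 => s(4, 1) | 2 => s(3, 4) | 3 => s(4, 0) | 4 => s(3, 5) | 5 => s(5, 6)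
  | 6 => s(5, 0) | 7 => s(6, 0) | 8 => s(6, 2) | 9 => s(2, 0) | 10 => s(5, 2) | 11 => s(3, 1)

/-- (H1) for `ex7b` in the region `{l}ᶜ`: as for `ex7e`, the neighbour `h` (reached twice) alone in
its component, the neighbour `4` adjacent to `h`, the neighbour `5` in the `h`-free component
`{2, 5, 6}`. -/
theorem ex7b_H1 : H1 ex7b ({0}ᶜ) 1 3 := by
  intro e p hep
  fin_cases e
  · -- `p = 1 = h` through the edge `0`
    have hp : p = 1 := by
      simp only [ex7b, Sym2.eq_iff] at hep
      omega
    subst hp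
    right
    intro q hq e' he'
    have hq1 : q = 1 := compU_subset_of_closed {1} rfl (by
      intro e x y _ hx _ hxS
      exfalso
      rw [Set.mem_singleton_iff] at hxS
      subst hxS
      exact hx.2 (by simp)) hq
    subst hq1
    fin_cases e' <;> simp [ex7b] at he'
  · exfalso
    simp only [ex7b, Sym2.eq_iff] at hep
    omega
  · -- `p = 4`
    have hp : p = 4 := by
      simp only [ex7b, Sym2.eq_iff] at hep
      omega
    subst hp
    exact Or.inl ⟨1, rfl⟩
  · exfalso
    simp only [ex7b, Sym2.eq_iff] at hep
    omega
  · -- `p = 5`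
    have hp : p = 5 := by
      simp only [ex7b, Sym2.eq_iff] at hep
      omega
    subst hp
    right
    intro q hq e' he'
    have hqS : q ∈ ({2, 5, 6} : Set (Fin 7)) := compU_subset_of_closed {2, 5, 6} (by simp) (by
      intro e x y hexy hx hy hxS
      simp only [Set.mem_insert_iff, Set.mem_singleton_iff] at hxS ⊢
      simp only [Set.mem_sdiff, Set.mem_compl_iff, Set.mem_singleton_iff, Set.mem_insert_iff,
        not_or] at hx hy
      fin_cases e <;> simp only [ex7b, Sym2.eq_iff] at hexy <;>
        rcases hexy with ⟨rfl, rfl⟩ | ⟨rfl, rfl⟩ <;> simp_all) hq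
    simp only [Set.mem_insert_iff, Set.mem_singleton_iff] at hqS
    rcases hqS with rfl | rfl | rfl <;> fin_cases e' <;> simp [ex7b] at he'
  all_goals
    try
      exfalso
      simp only [ex7b, Sym2.eq_iff] at hep
      omega
  · -- `p = 1 = h` through the edge `11`
    have hp : p = 1 := by
      simp only [ex7b, Sym2.eq_iff] at hep
      omega
    subst hp
    right
    intro q hq e' he'
    have hq1 : q = 1 := compU_subset_of_closed {1} rfl (by
      intro e x y _ hx _ hxS
      exfalso
      rw [Set.mem_singleton_iff] at hxS
      subst hxS
      exact hx.2 (by simp)) hq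
    subst hq1
    fin_cases e' <;> simp [ex7b] at he'

/-- **Row (SW) on `ex7b`**: the (H1) junction `3` joined to `h = 1` by two parallel edges — Theorem A
with a bundle `h–u`. -/
theorem sw_ex7b : Sw ex7b 0 1 2 := by
  refine sw_of_junctionH1_bundle (l := 0) (h := 1) (o := 2) (u := 3) (by decide) (by decide)
    (by decide) (by decide) ex7b_H1 ?_
  · intro x hx0 hx1 hx2 hx3
    fin_cases x
    · exact absurd rfl hx0
    · exact absurd rfl hx1
    · exact absurd rfl hx2
    · exact absurd rfl hx3
    · exact ⟨3, rfl⟩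
    · exact ⟨6, rfl⟩
    · exact ⟨7, rfl⟩

end LocRows

end Summit.Ventures.PercRepro2
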